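import Mathlib
import HarnessLib
import Summits.HubbardSuperconductivity.HubbardSuperconductivity.Theorems.KLProgrammeC4aPPKernelFarSRows
import Summits.HubbardSuperconductivity.HubbardSuperconductivity.Theorems.KLProgrammeC4aPPKernelMidFlatnessIdentity

/-!
# Route `KLProgramme` — crux C4a, S3 brick (B4) «(B4)-UMK1», «(U1)-FARS-ROWS» part 3: the ANTI-DIAGONAL FLATNESS IDENTITY for the smooth far piece
# `A_s = P·κ(r)` — `D²·∫_a^b ∂ᵤA_s(e, D−e) de = ∫_a^b [E_N·κ(r) + N·κ′(r)·ρ] de − [e·N·κ(r)]_a^b` (the twin of `…MidFlatnessIdentity` with `μ ↦ κ(r)`)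

Cell `gate-hubbard-kl`, seat hubbard-kl-k3c3-p1 (g17; row «δμ-flow with klAngularMean constant piece»).  Same Euler-defect mechanism as for the comparable-levels piece
(`E_N = e∂ₑN + u∂ᵤN`, `ρ = e∂ₑr + u∂ᵤr = lo²(e²−u²)/(m̃ₑm̃ᵤ(m̃ₑ+m̃ᵤ)²)`, `…MidFlatnessIdentity` §1), for the factor `κ(r)` in place of `1 − κ(r) − κ(1−r)`:
* `hasDerivAt_farFactor_antidiag` (`d/de κ(r(e,D−e))`), `hasDerivAt_farPhi_antidiag` (`Φ′`, `Φ = e·N(e,D−e)·κ(r)`), **`farFlatness_pointwise_identity`**,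
  continuity of the pieces, **`farFlatness_integral_identity`** (any `0 < D`, any `a b`).
Sizes (the `hflat` row) are part 4.  Pure real analysis; nothing asserts (C), K3, the window or superconductivity.
References: BGM 2006 §2.4 (2.36) [cite: BenfattoGiulianiMastropietro2006]; FST II CPAM 51 (1998) §3 [cite: FeldmanSalmhoferTrubowitz1998].
-/

noncomputable section

namespace Summit.HubbardSuperconductivity.HubbardSuperconductivity.Theorems.C4a

set_option linter.dupNamespace false -- summit = problem name (single-conjunct summit), D-0017

open Real Filter Set MeasureTheory intervalIntegral
open scoped Topology Interval
open Literature.MathematicalPhysics.QuantumLattice Literature.Analysis.SpecialFunctions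

section AlongLine

variable {β Λ : ℝ} (hβ : 0 < β) (hΛ : 0 < Λ) {B₁ : ℝ} (hB₁ : ∀ x, |deriv salmhoferCutoff x| ≤ B₁)
  {κ κ' : ℝ → ℝ} (hκ : ∀ t, HasDerivAt κ (κ' t) t) (hκ'c : Continuous κ') {lo : ℝ} (hlo : 0 < lo)

include hκ hlo in
/-- `d/de κ(r(e,D−e)) = κ′(r)·d/de r(e,D−e)`. [folklore] -/
theorem hasDerivAt_farFactor_antidiag (D e : ℝ) :
    HasDerivAt (fun x : ℝ => κ (ppSmoothRatio lo x (D - x)))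
      (κ' (ppSmoothRatio lo e (D - e)) *
        (((e / ppSmoothScale lo e) * ppSmoothScale lo (D - e) + ppSmoothScale lo e * ((D - e) / ppSmoothScale lo (D - e))) /
          (ppSmoothScale lo e + ppSmoothScale lo (D - e)) ^ 2)) e :=
  (hκ _).comp e (hasDerivAt_ppSmoothRatio_antidiag hlo D e)

include hβ hΛ hB₁ hκ hlo in
/-- **`Φ′ = N·κ(r) + e·n′·κ(r) + e·N·κ′(r)·(r∘antidiag)′`** for `Φ(e) = e·N(e,D−e)·κ(r(e,D−e))`. [cite: BenfattoGiulianiMastropietro2006, §2.4 (2.36)] -/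
theorem hasDerivAt_farPhi_antidiag (D e : ℝ) :
    HasDerivAt (fun x : ℝ => x * ppTrueNumerator β Λ x (D - x) * κ (ppSmoothRatio lo x (D - x)))
      (ppTrueNumerator β Λ e (D - e) * κ (ppSmoothRatio lo e (D - e)) +
        e * (ppTrueNumeratorDu β Λ (D - e) e - ppTrueNumeratorDu β Λ e (D - e)) * κ (ppSmoothRatio lo e (D - e)) +
        e * ppTrueNumerator β Λ e (D - e) * (κ' (ppSmoothRatio lo e (D - e)) *
          (((e / ppSmoothScale lo e) * ppSmoothScale lo (D - e) + ppSmoothScale lo e * ((D - e) / ppSmoothScale lo (D - e))) /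
            (ppSmoothScale lo e + ppSmoothScale lo (D - e)) ^ 2))) e := by
  have hn := hasDerivAt_ppTrueNumerator_line hβ hΛ hB₁ D e
  have hμ := hasDerivAt_farFactor_antidiag hκ hlo D e
  have h := (((hasDerivAt_id e).fun_mul hn).fun_mul hμ)
  refine (h.congr_of_eventuallyEq (Eventually.of_forall fun x => by simp only [id])).congr_deriv ?_
  simp only [id]
  ring

include hβ hΛ hB₁ hκ hlo in
/-- **THE POINTWISE FLATNESS IDENTITY FOR THE FAR PIECE** (`D ≠ 0`): `D²·∂ᵤA_s(e,D−e) = E_N·κ(r) + N·κ′(r)·ρ − Φ′(e)`.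
[cite: BenfattoGiulianiMastropietro2006, §2.4 (2.36)] -/
theorem farFlatness_pointwise_identity {D : ℝ} (hD : D ≠ 0) (e : ℝ) :
    D ^ 2 * deriv (fun v : ℝ => ppFarKernelS β Λ κ lo e v) (D - e) =
      (e * ppTrueNumeratorDu β Λ (D - e) e + (D - e) * ppTrueNumeratorDu β Λ e (D - e)) * κ (ppSmoothRatio lo e (D - e)) +
        ppTrueNumerator β Λ e (D - e) * κ' (ppSmoothRatio lo e (D - e)) *
          (lo ^ 2 * (e ^ 2 - (D - e) ^ 2) / (ppSmoothScale lo e * ppSmoothScale lo (D - e) * (ppSmoothScale lo e + ppSmoothScale lo (D - e)) ^ 2)) -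
        (ppTrueNumerator β Λ e (D - e) * κ (ppSmoothRatio lo e (D - e)) +
          e * (ppTrueNumeratorDu β Λ (D - e) e - ppTrueNumeratorDu β Λ e (D - e)) * κ (ppSmoothRatio lo e (D - e)) +
          e * ppTrueNumerator β Λ e (D - e) * (κ' (ppSmoothRatio lo e (D - e)) *
            (((e / ppSmoothScale lo e) * ppSmoothScale lo (D - e) + ppSmoothScale lo e * ((D - e) / ppSmoothScale lo (D - e))) /
              (ppSmoothScale lo e + ppSmoothScale lo (D - e)) ^ 2))) := by
  have hs : e + (D - e) ≠ 0 := by rw [add_sub_cancel]; exact hD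
  have h1 := ppSmoothScale_pos hlo e
  have h2 := ppSmoothScale_pos hlo (D - e)
  rw [(hasDerivAt_ppFarKernelS_u hβ hΛ hB₁ hκ hlo e (D - e)).deriv, ppTrueKernelDu_eq_of_ne hβ hΛ hB₁ hs, ppTrueKernel_eq_div hβ Λ hs,
    ← ppSmoothRatio_euler_identity hlo e (D - e)]
  rw [show e + (D - e) = D by ring]
  field_simp
  ring

include hβ hΛ hB₁ hκ hκ'c hlo in
/-- **THE ANTI-DIAGONAL FLATNESS IDENTITY FOR THE FAR PIECE** (`0 < D`, any `a b`):
`D²·∫_a^b ∂ᵤA_s(e, D−e) de = ∫_a^b [E_N(e)·κ(r) + N(e,D−e)·κ′(r)·ρ(e)] de − (Φ(b) − Φ(a))`, `Φ(e) = e·N(e,D−e)·κ(r(e,D−e))`.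
[cite: BenfattoGiulianiMastropietro2006, §2.4 (2.36)] -/
theorem farFlatness_integral_identity {D : ℝ} (hD : 0 < D) (a b : ℝ) :
    D ^ 2 * ∫ e in a..b, deriv (fun v : ℝ => ppFarKernelS β Λ κ lo e v) (D - e) =
      (∫ e in a..b, (e * ppTrueNumeratorDu β Λ (D - e) e + (D - e) * ppTrueNumeratorDu β Λ e (D - e)) * κ (ppSmoothRatio lo e (D - e)) +
        ppTrueNumerator β Λ e (D - e) * κ' (ppSmoothRatio lo e (D - e)) *
          (lo ^ 2 * (e ^ 2 - (D - e) ^ 2) / (ppSmoothScale lo e * ppSmoothScale lo (D - e) * (ppSmoothScale lo e + ppSmoothScale lo (D - e)) ^ 2))) -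
      (b * ppTrueNumerator β Λ b (D - b) * κ (ppSmoothRatio lo b (D - b)) - a * ppTrueNumerator β Λ a (D - a) * κ (ppSmoothRatio lo a (D - a))) := by
  have hN : Continuous fun e : ℝ => ppTrueNumerator β Λ e (D - e) :=
    continuous_iff_continuousAt.2 fun e => (hasDerivAt_ppTrueNumerator_line hβ hΛ hB₁ D e).continuousAt
  have hDe := continuous_ppTrueNumeratorDe_line hβ hΛ hB₁ D
  have hDu := continuous_ppTrueNumeratorDu_line hβ hΛ hB₁ D
  have hκc : Continuous κ := continuous_iff_continuousAt.2 fun t => (hκ t).continuousAt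
  have hr : Continuous fun e : ℝ => ppSmoothRatio lo e (D - e) :=
    (continuous_ppSmoothRatio₂ hlo).comp (continuous_id.prodMk (continuous_const.sub continuous_id))
  have hμ : Continuous fun e : ℝ => κ (ppSmoothRatio lo e (D - e)) := hκc.comp hr
  have hμ' : Continuous fun e : ℝ => κ' (ppSmoothRatio lo e (D - e)) := hκ'c.comp hr
  obtain ⟨hρ, hrl⟩ := continuous_euler_and_lineDeriv_antidiag hlo D
  have hΦ'c : Continuous fun e : ℝ =>
      ppTrueNumerator β Λ e (D - e) * κ (ppSmoothRatio lo e (D - e)) +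
        e * (ppTrueNumeratorDu β Λ (D - e) e - ppTrueNumeratorDu β Λ e (D - e)) * κ (ppSmoothRatio lo e (D - e)) +
        e * ppTrueNumerator β Λ e (D - e) * (κ' (ppSmoothRatio lo e (D - e)) *
          (((e / ppSmoothScale lo e) * ppSmoothScale lo (D - e) + ppSmoothScale lo e * ((D - e) / ppSmoothScale lo (D - e))) /
            (ppSmoothScale lo e + ppSmoothScale lo (D - e)) ^ 2)) :=
    ((hN.mul hμ).add ((continuous_id.mul (hDe.sub hDu)).mul hμ)).add ((continuous_id.mul hN).mul (hμ'.mul hrl))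
  have hFTC := intervalIntegral.integral_eq_sub_of_hasDerivAt (fun e _ => hasDerivAt_farPhi_antidiag hβ hΛ hB₁ hκ hlo D e) (hΦ'c.intervalIntegrable a b)
  have hRc : Continuous fun e : ℝ => (e * ppTrueNumeratorDu β Λ (D - e) e + (D - e) * ppTrueNumeratorDu β Λ e (D - e)) * κ (ppSmoothRatio lo e (D - e)) +
      ppTrueNumerator β Λ e (D - e) * κ' (ppSmoothRatio lo e (D - e)) *
        (lo ^ 2 * (e ^ 2 - (D - e) ^ 2) / (ppSmoothScale lo e * ppSmoothScale lo (D - e) * (ppSmoothScale lo e + ppSmoothScale lo (D - e)) ^ 2)) :=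
    (((continuous_id.mul hDe).add ((continuous_const.sub continuous_id).mul hDu)).mul hμ).add ((hN.mul hμ').mul hρ)
  rw [← intervalIntegral.integral_const_mul]
  have hpt : ∀ e : ℝ, D ^ 2 * deriv (fun v : ℝ => ppFarKernelS β Λ κ lo e v) (D - e) = _ := fun e => farFlatness_pointwise_identity hβ hΛ hB₁ hκ hlo hD.ne' e
  simp_rw [hpt]
  rw [intervalIntegral.integral_sub (hRc.intervalIntegrable a b) (hΦ'c.intervalIntegrable a b), hFTC]

end AlongLine

end Summit.HubbardSuperconductivity.HubbardSuperconductivity.Theorems.C4a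

end
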